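import Literature.NumberTheory.Automorphic.AutomorphicInductionCuspidalUnramifiedTraceIdentity
import Literature.NumberTheory.Automorphic.ArthurClozelGalOrbitDescentOffS
import Summits.Langlands.Langlands.Theses.QuadraticWindow
import HarnessLib

/-!
# Crux `QuadraticWindow.AutomorphicInductionUnramified` (stmt-Langlands-15138), line `Sketch`:
# the `S`-threaded Thm. 4.2 (e) from the controlled trace-identity outputs

Sanity stub `stub_offS_of_isobaricFamilies` of the line `Sketch` (`s-threaded-comparison`) of the
crux `AutomorphicInductionUnramified`: the one theory-sized leaf of the line, Arthur–Clozel's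
Thm. 4.2 (e) (Ann. of Math. Stud. 120, Ch. 3) with the spherical set `S` of the comparison
(4.1) = (4.2) threaded through
(`Literature.NumberTheory.Automorphic.ArthurClozel1989_descent_of_galOrbit_offS`), follows from
EXACTLY the hypotheses of the tree's
`automorphicInduction_cyclic_cuspidal_unramified_of_isobaricFamilies` — the trace-identity outputs
`hI`, `hId` (Thm. 4.2 (a), (b), (d) in the ranks `< l m`), the controlled orbit output `hIeS`,
multiplicity one `hm1` and Jacquet–Shalika (2.2)–(2.3) `h22a`–`h23`.  So the new leaf adds no debt
beyond the residue the tree already records for `ArthurClozel1989_descent_of_galOrbit`.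

Proof (Steps 1–6 of `strongLifting_galOrbit_unramified_of_isobaricFamilies`, run at the given
`S` instead of the admissible `S₀`): fold `ν` into a family of automorphic measures over `E` and
choose one over `F`; run `hIeS` off `S`; enlarge `S` by the levels of `η`; Thm. 4.2 (a), (b) in the
lower ranks (`exists_cuspidal_weakLift_family_of_isobaricLiftFamilies`,
`exists_galOrbitLift_family_of_isobaricLiftFamilies`); "`r = 1`"
(`exists_orbitDescent_of_isobaricOrbitDescent`): one member, of rank `l m` and shift `0`, lifted by
the orbit, so the relation off `S` reads `∑_σ A σ w = α(v)^{f(w|v)}`; transport along the rank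
equality; `π ⊗ η = π` (`twistByFiniteOrderChar_eq_of_isWeakBaseChangeLiftOfGalOrbit`) and
uniqueness (`eq_of_isWeakBaseChangeLiftOfGalOrbit_of_character`).
-/

noncomputable section

open scoped Classical
open NumberField IsDedekindDomain MeasureTheory Filter
open Literature.NumberTheory.Automorphic Literature.NumberTheory.Automorphic.AdelicGroupData
open Literature.NumberTheory.GaloisRepresentations (HeckeCharacter)

-- `Summit.Langlands.Langlands.…` (summit = sub-problem name, D-0017 layout) trips `dupNamespace`.
set_option linter.dupNamespace false

namespace Summit.Langlands.Langlands.Theorems.AutomorphicInductionUnramified.Sketch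

/-- **The `S`-threaded Thm. 4.2 (e) from the controlled trace-identity outputs** — exactly the
hypotheses of `automorphicInduction_cyclic_cuspidal_unramified_of_isobaricFamilies` (the comparison
outputs `hI`, `hId`, `hIeS`, multiplicity one, Jacquet–Shalika (2.2)–(2.3)); the template is Steps 1–6
of `strongLifting_galOrbit_unramified_of_isobaricFamilies` ("`r = 1`",
`exists_orbitDescent_of_isobaricOrbitDescent`; `π ⊗ η = π` by
`twistByFiniteOrderChar_eq_of_isWeakBaseChangeLiftOfGalOrbit`; uniqueness by
`eq_of_isWeakBaseChangeLiftOfGalOrbit_of_character`).  So the new leaf adds no debt beyond the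
residue the tree already records for `ArthurClozel1989_descent_of_galOrbit`. -/
theorem stub_offS_of_isobaricFamilies
    (hI : ∀ {n : ℕ} {F E : Type} [Field F] [NumberField F] [Field E] [NumberField E]
      [Algebra F E] [IsGalois F E], (Module.finrank F E).Prime → 0 < n →
      ∀ (μ : Measure (gl n F).automorphicQuotient) [(gl n F).IsAutomorphicMeasure μ]
        (P : CuspidalAutomorphicRepGL n F μ)
        (ν : (a : ℕ) → Measure (gl a E).automorphicQuotient)
        [∀ a, (gl a E).IsAutomorphicMeasure (ν a)],
        ∃ (M : Type) (_ : Fintype M) (d : M → ℕ)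
          (Q : ∀ m, CuspidalAutomorphicRepGL (d m) E (ν (d m))) (s : M → ℂ)
          (S : Set (HeightOneSpectrum (𝓞 F))) (α : SatakeFamily F) (A : M → SatakeFamily E),
          (∀ m, 0 < d m) ∧ ∑ m, d m = n ∧ ∑ m, (d m : ℂ) * s m = 0 ∧ S.Finite ∧
          IsSatakeFamilyOf P S α ∧
          (∀ m, IsSatakeFamilyOf (Q m) {w | w.under (𝓞 F) ∈ S} (A m)) ∧
          ∀ w : HeightOneSpectrum (𝓞 E), w.under (𝓞 F) ∉ S →
            (α (w.under (𝓞 F))).map (· ^ w.asIdeal.inertiaDeg (𝓞 F)) =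
              ∑ m, (A m w).map (((w.residueCard : ℂ) ^ (-(s m))) * ·))
    (hId : ∀ {n : ℕ} {F E : Type} [Field F] [NumberField F] [Field E] [NumberField E]
      [Algebra F E] [IsGalois F E], (Module.finrank F E).Prime → 0 < n →
      ∀ (ν : Measure (gl n E).automorphicQuotient) [(gl n E).IsAutomorphicMeasure ν]
        (hν : IsGalInvariant F ν) (Q : CuspidalAutomorphicRepGL n E ν),
        (∀ σ : E ≃ₐ[F] E, Q.IsGalStable F hν σ) →
        ∀ (μ : (m : ℕ) → Measure (gl m F).automorphicQuotient)
          [∀ m, (gl m F).IsAutomorphicMeasure (μ m)],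
        ∃ (ι : Type) (_ : Fintype ι) (d : ι → ℕ)
          (P : ∀ i, CuspidalAutomorphicRepGL (d i) F (μ (d i))) (s : ι → ℂ)
          (S : Set (HeightOneSpectrum (𝓞 F))) (α : ι → SatakeFamily F) (B : SatakeFamily E),
          (∀ i, 0 < d i) ∧ ∑ i, d i = n ∧ ∑ i, (d i : ℂ) * s i = 0 ∧ S.Finite ∧
          (∀ i, IsSatakeFamilyOf (P i) S (α i)) ∧
          IsSatakeFamilyOf Q {w | w.under (𝓞 F) ∈ S} B ∧
          ∀ w : HeightOneSpectrum (𝓞 E), w.under (𝓞 F) ∉ S →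
            B w = (∑ i, (α i (w.under (𝓞 F))).map
              ((((w.under (𝓞 F)).residueCard : ℂ) ^ (-(s i))) * ·)).map
                (· ^ w.asIdeal.inertiaDeg (𝓞 F)))
    (hIeS : ∀ {m : ℕ} {F E : Type} [Field F] [NumberField F] [Field E] [NumberField E]
      [Algebra F E] [IsGalois F E], (Module.finrank F E).Prime → 0 < m →
      ∀ (ν : Measure (gl m E).automorphicQuotient) [(gl m E).IsAutomorphicMeasure ν]
        (hν : IsGalInvariant F ν) (Q₁ : CuspidalAutomorphicRepGL m E ν),
        (∃ σ : E ≃ₐ[F] E, ¬ Q₁.IsGalStable F hν σ) →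
        ∀ (μ : (a : ℕ) → Measure (gl a F).automorphicQuotient)
          [∀ a, (gl a F).IsAutomorphicMeasure (μ a)]
          (S : Set (HeightOneSpectrum (𝓞 F))), S.Finite →
          (∀ v ∉ S, Algebra.IsUnramifiedIn (𝓞 E) v.asIdeal) →
          (∀ σ : E ≃ₐ[F] E, ∀ w : HeightOneSpectrum (𝓞 E), w.under (𝓞 F) ∉ S →
            IsUnramifiedAt (Q₁.galConj F hν σ).1 w) →
        ∃ (ι : Type) (_ : Fintype ι) (d : ι → ℕ)
          (P : ∀ i, CuspidalAutomorphicRepGL (d i) F (μ (d i))) (s : ι → ℂ)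
          (α : ι → SatakeFamily F) (A : (E ≃ₐ[F] E) → SatakeFamily E),
          (∀ i, 0 < d i) ∧ ∑ i, d i = Module.finrank F E * m ∧ ∑ i, (d i : ℂ) * s i = 0 ∧
          (∀ i, IsSatakeFamilyOf (P i) S (α i)) ∧
          (∀ σ, IsSatakeFamilyOf (Q₁.galConj F hν σ) {w | w.under (𝓞 F) ∈ S} (A σ)) ∧
          ∀ w : HeightOneSpectrum (𝓞 E), w.under (𝓞 F) ∉ S →
            ∑ σ, A σ w = (∑ i, (α i (w.under (𝓞 F))).map
              ((((w.under (𝓞 F)).residueCard : ℂ) ^ (-(s i))) * ·)).map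
                (· ^ w.asIdeal.inertiaDeg (𝓞 F)))
    (hm1 : ∀ (n : ℕ) (K : Type) [Field K] [NumberField K]
      (μ : Measure (gl n K).automorphicQuotient) [(gl n K).IsAutomorphicMeasure μ],
      multiplicity_one_gl n K μ)
    (h22a : ∀ (n m : ℕ) (K : Type) [Field K] [NumberField K]
      (μ : Measure (gl n K).automorphicQuotient) [(gl n K).IsAutomorphicMeasure μ]
      (μ' : Measure (gl m K).automorphicQuotient) [(gl m K).IsAutomorphicMeasure μ'],
      JacquetShalika1981_partialPairL_boundary_of_ne_one (n := n) (m := m) (K := K) (μ := μ)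
        (μ' := μ'))
    (h22b : ∀ (n m : ℕ) (K : Type) [Field K] [NumberField K]
      (μ : Measure (gl n K).automorphicQuotient) [(gl n K).IsAutomorphicMeasure μ]
      (μ' : Measure (gl m K).automorphicQuotient) [(gl m K).IsAutomorphicMeasure μ'],
      JacquetShalika1981_partialPairL_at_one_of_rank_ne (n := n) (m := m) (K := K) (μ := μ)
        (μ' := μ'))
    (h22c : ∀ (n : ℕ) (K : Type) [Field K] [NumberField K]
      (μ : Measure (gl n K).automorphicQuotient) [(gl n K).IsAutomorphicMeasure μ],
      JacquetShalika1981_partialPairL_at_one_of_ne_conj (n := n) (K := K) (μ := μ))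
    (h23 : ∀ (n : ℕ) (K : Type) [Field K] [NumberField K]
      (μ : Measure (gl n K).automorphicQuotient) [(gl n K).IsAutomorphicMeasure μ],
      JacquetShalika1981_partialPairL_pole_of_eq_conj (n := n) (K := K) (μ := μ))
    (F E : Type) [Field F] [NumberField F] [Field E] [NumberField E] [Algebra F E] (m : ℕ) :
    ArthurClozel1989_descent_of_galOrbit_offS F E m := by
  intro _ hm hℓ η hη ν hνA _ hν Q₁ hQ S hS hunr hram
  classical
  haveI : FiniteDimensional F E := Module.finite_of_finrank_pos hℓ.pos
  have hN : 0 < Module.finrank F E * m := Nat.mul_pos hℓ.pos hm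
  /- Step 1: fold `ν` into a family of automorphic measures over `E`; choose one over `F`. -/
  obtain ⟨νE, hνE, hνn⟩ : ∃ (νE : (a : ℕ) → Measure (gl a E).automorphicQuotient)
      (_ : ∀ a, (gl a E).IsAutomorphicMeasure (νE a)), νE m = ν := by
    refine ⟨Function.update (fun a => Classical.choose
      (AdelicGroupData.exists_isAutomorphicMeasure_gl_holds a E)) m ν, fun a => ?_,
      by simp only [Function.update_self]⟩
    by_cases h : a = m
    · subst h
      rw [Function.update_self]
      exact hνA
    · rw [Function.update_of_ne h]
      exact Classical.choose_spec (AdelicGroupData.exists_isAutomorphicMeasure_gl_holds a E)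
  subst hνn
  haveI : ∀ a, (gl a E).IsAutomorphicMeasure (νE a) := hνE
  have hνG : ∀ a, IsGalInvariant F (νE a) := fun a =>
    isGalInvariant_of_unique F (isAutomorphicMeasure_unique_smul_holds a E) (νE a)
  choose μF hμF using fun a => AdelicGroupData.exists_isAutomorphicMeasure_gl_holds a F
  haveI : ∀ a, (gl a F).IsAutomorphicMeasure (μF a) := hμF
  /- Step 2 is void: the class-field character `η` is given.
     Step 3: the controlled datum off `S`, and the exceptional set of the descent. -/
  obtain ⟨ι, _, nF, π, u, αF, A, hnF, hnFsum, hus, hαF, hA, hrelE⟩ :=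
    hIeS hℓ hm (νE m) hν Q₁ hQ μF S hS hunr hram
  choose 𝔪i h𝔪i hη𝔪i using fun i =>
    HeckeCharacter.exists_level_of_isFiniteOrder (nF i) hη.isFiniteOrder
  have h𝔪ifin : (⋃ i, {v : HeightOneSpectrum (𝓞 F) | v.asIdeal ∣ 𝔪i i}).Finite :=
    Set.finite_iUnion fun i => Ideal.finite_factors (h𝔪i i)
  set S' : Set (HeightOneSpectrum (𝓞 F)) :=
    S ∪ ⋃ i, {v : HeightOneSpectrum (𝓞 F) | v.asIdeal ∣ 𝔪i i} with hS'def
  have hS' : S'.Finite := hS.union h𝔪ifin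
  have hmemS' : ∀ v, v ∈ S' ↔ v ∈ S ∨ ∃ i, v.asIdeal ∣ 𝔪i i := fun v => by
    simp only [hS'def, Set.mem_union, Set.mem_iUnion, Set.mem_setOf_eq]
  have hSS' : S ⊆ S' := fun v hv => (hmemS' v).mpr (Or.inl hv)
  have h𝔪iS' : ∀ i, ∀ v ∉ S', ¬ v.asIdeal ∣ 𝔪i i := fun i v hv h =>
    hv ((hmemS' v).mpr (Or.inr ⟨i, h⟩))
  have hunrS' : ∀ v ∉ S', Algebra.IsUnramifiedIn (𝓞 E) v.asIdeal := fun v hv =>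
    hunr v fun h => hv (hSS' h)
  have hSE : {w : HeightOneSpectrum (𝓞 E) | w.under (𝓞 F) ∈ S} ⊆ {w | w.under (𝓞 F) ∈ S'} :=
    fun w hw => hSS' hw
  /- Step 4: Thm. 4.2 (a), (b) in the ranks `< ℓ m`, from `hI`, `hId`. -/
  have hlifta : ∀ i, nF i < Module.finrank F E * m →
      (π i).twistByFiniteOrderChar η hη.isFiniteOrder ≠ π i →
        ∃ Q : CuspidalAutomorphicRepGL (nF i) E (νE (nF i)), IsWeakBaseChangeLift (π i).1 Q.1 :=
    fun i _ hne => exists_cuspidal_weakLift_family_of_isobaricLiftFamilies hI hm1 h22a h22b h22c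
      h23 (hnF i) hℓ η hη (μF (nF i)) (π i) hne νE
  have hliftb : ∀ i, nF i < Module.finrank F E * m →
      (π i).twistByFiniteOrderChar η hη.isFiniteOrder = π i →
        ∃ (b : ℕ) (Q' : CuspidalAutomorphicRepGL b E (νE b)), Module.finrank F E * b = nF i ∧
          IsWeakBaseChangeLiftOfGalOrbit (π i).1 Q' (hνG b) := by
    intro i _ heq
    obtain ⟨b, Q', hb, -, hl⟩ := exists_galOrbitLift_family_of_isobaricLiftFamilies hI hm1 h22a
      h22b h22c h23 (hnF i) hℓ η hη (μF (nF i)) (π i) heq νE hνG fun a _ =>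
        arthurClozel1989_exists_cuspidal_descent_of_isGalStable_of_isobaricFamilies' hId hm1 h22a
          h22b h22c h23
    exact ⟨b, Q', hb, hl⟩
  /- Step 5: the descent: one member `i₀`, of rank `ℓ m` and shift `0`, lifted by the orbit. -/
  obtain ⟨i₀, hrank, hlift₀⟩ := exists_orbitDescent_of_isobaricOrbitDescent hℓ νE hνG
    (fun a b => h22a a b E (νE a) (νE b)) (fun a b => h22b a b E (νE a) (νE b))
    (fun a => h22c a E (νE a)) (fun a => h23 a E (νE a)) (fun a => hm1 a E (νE a)) μF
    (fun a b => h22a a b F (μF a) (μF b)) (fun a b => h22b a b F (μF a) (μF b))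
    (fun a => h22c a F (μF a)) (fun a => h23 a F (μF a)) (fun a => hm1 a F (μF a)) hη hm Q₁ hQ
    nF hnF π u hnFsum hus 𝔪i h𝔪i hη𝔪i hS' h𝔪iS' hunrS' (fun i => (hαF i).mono hSS')
    (fun σ => (hA σ).mono hSE) (fun w hw => hrelE w fun h => hw (hSS' h)) hlifta hliftb
  have huniq : ∀ i, i = i₀ := by
    intro i
    by_contra hne
    have h2 : nF i₀ + nF i ≤ ∑ j, nF j := by
      rw [← Finset.sum_pair (Ne.symm hne)]
      exact Finset.sum_le_sum_of_subset_of_nonneg (Finset.subset_univ _) fun _ _ _ => Nat.zero_le _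
    rw [hnFsum, hrank] at h2
    have := hnF i
    omega
  have hsum1 : ∀ {N : Type} [AddCommMonoid N] (f : ι → N), ∑ i, f i = f i₀ := fun f =>
    Finset.sum_eq_single i₀ (fun i _ hne => absurd (huniq i) hne)
      fun h => absurd (Finset.mem_univ i₀) h
  have hu0 : u i₀ = 0 := by
    rw [hsum1] at hus
    exact (mul_eq_zero.mp hus).resolve_left (Nat.cast_ne_zero.mpr (hnF i₀).ne')
  have hrel1 : ∀ w : HeightOneSpectrum (𝓞 E), w.under (𝓞 F) ∉ S →
      ∑ σ, A σ w = (αF i₀ (w.under (𝓞 F))).map (· ^ w.asIdeal.inertiaDeg (𝓞 F)) := by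
    intro w hw
    rw [hrelE w hw, hsum1, hu0, neg_zero, Complex.cpow_zero]
    simp only [one_mul, Multiset.map_id']
  /- Step 6: transport along the rank equality; `π ⊗ η = π` and uniqueness. -/
  obtain ⟨P, hαP, hliftP⟩ :=
    exists_of_rank_eq_isSatakeFamilyOf (E := E) hrank μF (π i₀) (hαF i₀) hlift₀
  refine ⟨μF (Module.finrank F E * m), inferInstance, P, αF i₀, A, hliftP, ?_, ?_, hαP, hA,
    hrel1⟩
  · exact twistByFiniteOrderChar_eq_of_isWeakBaseChangeLiftOfGalOrbit hN hm hℓ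
      (h22c _ F (μF (Module.finrank F E * m))) (h23 _ F (μF (Module.finrank F E * m)))
      (h22c m E (νE m)) (h23 m E (νE m)) (hm1 _ F (μF (Module.finrank F E * m)))
      (hm1 m E (νE m)) η hη hliftP
  · exact fun P' hP' => eq_of_isWeakBaseChangeLiftOfGalOrbit_of_character hN hm hℓ.two_le
      (h22c _ F (μF (Module.finrank F E * m))) (h23 _ F (μF (Module.finrank F E * m)))
      (h22c m E (νE m)) (h23 m E (νE m)) (hm1 _ F (μF (Module.finrank F E * m)))
      (hm1 m E (νE m)) hη.isFiniteOrder (hη.eventually_isPrimitiveRoot_valueAtUniformizer hℓ)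
      hliftP hP'

end Summit.Langlands.Langlands.Theorems.AutomorphicInductionUnramified.Sketch

end
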